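import Summits.Ventures.LatticeQCDFlow.Exactness.Phi4HMCFluctuationRelation
import Summits.Ventures.LatticeQCDFlow.Exactness.StdGaussianWedgeProbabilities
import HarnessLib

/-!
# The exact free-field check of the LOCAL arm's acceptance column: the Gaussian-step Metropolis
# update `φ ↦ φ + u`, `u ∼ N(0, v)`, on a Gaussian mode `N(0, a)` is accepted with probability EXACTLY
# `ā = (2/π)·arctan(2√a/√v)`, inside `[1 − √v/(π√a), 4√a/(π√v)]`

HONEST FRAMING: exact (Metropolis-corrected) sampling algorithms for lattice gauge theory;
figures of merit are autocorrelation/cost numbers at stated couplings and volumes; no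
continuum-physics claim.  (SCALAR calibration rung S0-A: not a gauge result.)

Venture `LatticeQCDFlow` (cell pub-lqcd), topic `Exactness`; FANOUT row 2 (`s0-phi4`, LOCAL arm; the
row's battery item "exact free-field limit check", local-update column).  NEW WORK of the cell,
composing row 2's involution framework `Phi4HMCFluctuationRelation` (`acceptance_integral_eq`: for a
measure-preserving involution the equilibrium acceptance is `P(ΔH ≤ 0) + P(ΔH < 0)`; the site update
IS such an involution — `Phi4MetropolisSiteInvolution` — here in its one-mode form on `ℝ × ℝ`) with
this session's `StdGaussianWedgeProbabilities` (the axis-adjacent wedge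
`(N(0,1)⊗N(0,1)){z₁(z₁ + cz₂) < 0} = (1/π)·arctan c`, from row 13's cone lemma
`GeneralNCMC.gaussianReal_prod_measure_abs_le_mul_abs`, and the product-Gaussian bookkeeping).  Nothing is
cited as a fact; no definition.  Printed counterpart NAMED ONLY: the one-dimensional Gaussian
random-walk Metropolis acceptance `(2/π)·arctan(2/ℓ)` (proposal s.d. `ℓ` in target units) of the
optimal-scaling literature (Roberts–Gelman–Gilks 1997; Sherlock–Roberts 2009, as a worked example).

ROUTE.  `ΔS = u(2φ+u)/(2a)`; the shear-and-flip `Ψ(u,φ) = (−u, φ+u)` preserves Lebesgue measure and has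
`ΔH = ΔS` for `e^{−H} = ρ_v(u)p_a(φ)`, so `ā = P(U(2Φ+U) ≤ 0) + P(U(2Φ+U) < 0)` (ties are two null
lines); standardised, `{U(2Φ+U) < 0}` is the WEDGE `{Z₁(Z₁ + cZ₂) < 0}`, `c = 2√a/√v`, which with its
mirror image `Z₂ ↦ −Z₂` tiles the open double cone `{|Z₁| < c|Z₂|}` up to the null axis — the
complement of the tree's closed cone `{|Z₂| ≤ c⁻¹|Z₁|}` of mass `(2/π)·arctan c⁻¹ = 1 − (2/π)·arctan c`.

## What is proved (`a v : ℝ≥0`, both `≠ 0`; Lebesgue reference on `ℝ × ℝ`, coordinates `(u, φ)`)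

* §1 (the map's measurability / involutivity are private copies of `measurable_rwShear_window'`,
  `rwShear_window_involutive` of row 2's `UniformWindowMetropolisSiteAcceptance` — no hub olean yet at filing
  time) `measurePreserving_rwShear`, `deltaH_rwShear_eq`
  (`ΔH = u(2φ+u)/(2a)`), **`gaussianSite_meanAccept_eq_signProb`**
  (`∫∫ min(1, e^{−ΔS}) ρ_v p_a = P(U(2Φ+U) ≤ 0) + P(U(2Φ+U) < 0)` as weighted indicator integrals);
* §3 **`gaussianSite_meanAccept`** — `∫∫ min(1, e^{−u(2φ+u)/(2a)}) ρ_v(u) p_a(φ) du dφ =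
  (2/π)·arctan(2√a/√v)` (standardise; the event is the wedge `{Z₁(Z₁ + cZ₂) < 0}`, `c = 2√a/√v`,
  plus two null lines);
* §4 **`gaussianSite_meanAccept_bounds`** — `1 − √v/(π√a) ≤ ā ≤ 4√a/(π√v)` (`π/2 − 1/x ≤ arctan x ≤ x`):
  small steps are accepted up to a deficit linear in `σ_step/σ_π`, large steps with probability
  `≈ (4/π)·σ_π/σ_step`;
* §5 `gaussianSite_meanDeltaS` (`⟨ΔS⟩ = v/(2a)` under `N(0,v) ⊗ N(0,a)`),
  **`gaussianSite_meanAccept_eq_meanEnergyChange`** — `ā = 1 − (2/π)·arctan √(⟨ΔS⟩/2)`: the SAME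
  curve in the mean proposed energy change as the free-field HMC mode law
  (`FreeFieldHMCModeAcceptance`, `ā = 1 − (2/π)·arctan √(⟨ΔH⟩/2)`).

Reading for S0-A (no numerics implied beyond the displayed constants): a certified test value for the
calibration engine's local-Metropolis acceptance column at `λ = 0`, per mode: step s.d. equal to the
mode's s.d. (`v = a`) gives `(2/π)·arctan 2 = 0.7048`, `v = 4a` gives `½`, `v = 16a` gives
`(2/π)·arctan ½ = 0.2952`.  Companions: `GaussianFlowModeAcceptance` (flow arm: `(4/π)·arctan r`) and
`AcceptanceGaussianEnergyViolation` (HMC arm under a Gaussian violation law).  At `λ = 0` on the LATTICE the same law holds site by site with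
`a = 1/A_xx` (`A` the free action's precision matrix): `ΔS_x = u(Aφ)_x + ½A_xx u²` and
`(Aφ)_x ∼ N(0, A_xx)` in equilibrium, independent of `u` — the one-mode computation verbatim (this
lattice reading is NOT typed here).  NOT CLAIMED: `λ > 0`
(the tree's `Phi4MetropolisSite*` floors hold there); the interacting or many-site acceptance; the
optimal `v` for any figure of merit (`Phi4MetropolisOptimalAcceptance`); any value for any run.
-/

namespace Summit.Ventures.LatticeQCDFlow.Exactness

open Real MeasureTheory ProbabilityTheory Filter Set
open scoped NNReal ENNReal

section GaussianSite

variable {a v : ℝ≥0}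

/-! ## §1 The random-walk site update on one Gaussian mode as a volume-preserving involution -/

/-- `Ψ` is an involution (private copy: the public statement is `rwShear_window_involutive` of row 2's
`UniformWindowMetropolisSiteAcceptance`, whose module has no hub olean at the time of filing). -/
private theorem rwShear_involutive' : Function.Involutive (fun p : ℝ × ℝ => (-p.1, p.2 + p.1)) := by
  intro p; ext <;> simp

/-- `Ψ` is measurable (private copy of `measurable_rwShear_window'`, same reason). -/
private theorem measurable_rwShear'' : Measurable (fun p : ℝ × ℝ => (-p.1, p.2 + p.1)) :=
  measurable_fst.neg.prodMk (measurable_snd.add measurable_fst)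

/-- `Ψ` preserves Lebesgue measure on `ℝ × ℝ` (skew product of `u ↦ −u` with the translations
`φ ↦ φ + u`). -/
theorem measurePreserving_rwShear :
    MeasurePreserving (fun p : ℝ × ℝ => (-p.1, p.2 + p.1))
      ((volume : Measure ℝ).prod (volume : Measure ℝ)) ((volume : Measure ℝ).prod (volume : Measure ℝ)) := by
  have hneg : MeasurePreserving (fun u : ℝ => -u) volume volume := Measure.measurePreserving_neg volume
  have hgm : Measurable (Function.uncurry fun (u : ℝ) (φ : ℝ) => φ + u) := measurable_snd.add measurable_fst
  exact MeasurePreserving.skew_product (μc := (volume : Measure ℝ)) (μd := (volume : Measure ℝ)) hneg hgm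
    (Eventually.of_forall fun u => (measurePreserving_add_right (volume : Measure ℝ) u).map_eq)

/-- The energy `H(u, φ) = −log ρ_v(u) − log p_a(φ)` (`e^{−H} = ρ_v(u) p_a(φ)`): its violation under
`Ψ` is the proposed action change of the quadratic mode, `ΔH = ((φ+u)² − φ²)/(2a) = u(2φ + u)/(2a)`. -/
theorem deltaH_rwShear_eq (ha : a ≠ 0) (hv : v ≠ 0) (p : ℝ × ℝ) :
    deltaH (fun q : ℝ × ℝ => -Real.log (gaussianPDFReal 0 v q.1) - Real.log (gaussianPDFReal 0 a q.2))
        (fun q => (-q.1, q.2 + q.1)) p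
      = p.1 * (2 * p.2 + p.1) / (2 * a) := by
  have ha' : (a : ℝ) ≠ 0 := NNReal.coe_ne_zero.mpr ha
  have hv' : (v : ℝ) ≠ 0 := NNReal.coe_ne_zero.mpr hv
  unfold deltaH
  simp only [gaussianPDFReal_def, sub_zero]
  rw [Real.log_mul (by positivity) (Real.exp_pos _).ne', Real.log_mul (by positivity) (Real.exp_pos _).ne',
    Real.log_mul (by positivity) (Real.exp_pos _).ne', Real.log_mul (by positivity) (Real.exp_pos _).ne',
    Real.log_exp, Real.log_exp, Real.log_exp, Real.log_exp]
  field_simp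
  ring

/-- **THE ACCEPTANCE COUNTS INWARD MOVES TWICE**: the equilibrium acceptance of the random-walk site
update with steps `N(0, v)` on the Gaussian mode `N(0, a)` equals
`P(U(2Φ + U) ≤ 0) + P(U(2Φ + U) < 0)`, `U ∼ N(0,v)`, `Φ ∼ N(0,a)` independent
(a move is accepted for sure iff it lands closer to the mode: `|Φ + U| ≤ |Φ|`). -/
theorem gaussianSite_meanAccept_eq_signProb (ha : a ≠ 0) (hv : v ≠ 0) :
    ∫ p : ℝ × ℝ, min 1 (Real.exp (-(p.1 * (2 * p.2 + p.1) / (2 * a))))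
        * (gaussianPDFReal 0 v p.1 * gaussianPDFReal 0 a p.2) ∂((volume : Measure ℝ).prod volume)
      = (∫ p : ℝ × ℝ, (if p.1 * (2 * p.2 + p.1) / (2 * a) ≤ 0 then (1 : ℝ) else 0)
          * (gaussianPDFReal 0 v p.1 * gaussianPDFReal 0 a p.2) ∂((volume : Measure ℝ).prod volume))
        + ∫ p : ℝ × ℝ, (if p.1 * (2 * p.2 + p.1) / (2 * a) < 0 then (1 : ℝ) else 0)
          * (gaussianPDFReal 0 v p.1 * gaussianPDFReal 0 a p.2) ∂((volume : Measure ℝ).prod volume) := by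
  have hHm : Measurable (fun q : ℝ × ℝ =>
      -Real.log (gaussianPDFReal 0 v q.1) - Real.log (gaussianPDFReal 0 a q.2)) :=
    ((Real.measurable_log.comp ((measurable_gaussianPDFReal 0 v).comp measurable_fst)).neg).sub
      (Real.measurable_log.comp ((measurable_gaussianPDFReal 0 a).comp measurable_snd))
  have hexp : Integrable (fun q : ℝ × ℝ =>
      Real.exp (-(-Real.log (gaussianPDFReal 0 v q.1) - Real.log (gaussianPDFReal 0 a q.2))))
      ((volume : Measure ℝ).prod volume) := by
    have h : Integrable (fun q : ℝ × ℝ => gaussianPDFReal 0 v q.1 * gaussianPDFReal 0 a q.2)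
        ((volume : Measure ℝ).prod volume) :=
      (integrable_gaussianPDFReal 0 v).mul_prod (integrable_gaussianPDFReal 0 a)
    exact h.congr (Eventually.of_forall fun q => (exp_neg_rwEnergy ha hv q).symm)
  have h := acceptance_integral_eq hHm measurable_rwShear'' rwShear_involutive' measurePreserving_rwShear hexp
  simp only [deltaH_rwShear_eq ha hv, exp_neg_rwEnergy ha hv] at h
  exact h

/-! ## §3 The acceptance law `ā = (2/π)·arctan(2σ_π/σ_step)` -/

/-- **THE EXACT ACCEPTANCE OF THE GAUSSIAN-STEP METROPOLIS UPDATE ON A GAUSSIAN MODE**: target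
`N(0, a)`, random-walk proposal `φ ↦ φ + u`, `u ∼ N(0, v)` (`a, v ≠ 0`); in equilibrium
`∫∫ min(1, e^{−ΔS}) ρ_v(u) p_a(φ) du dφ = (2/π)·arctan(2√a/√v)`, `ΔS = u(2φ + u)/(2a)`. -/
theorem gaussianSite_meanAccept (ha : a ≠ 0) (hv : v ≠ 0) :
    ∫ p : ℝ × ℝ, min 1 (Real.exp (-(p.1 * (2 * p.2 + p.1) / (2 * a))))
        * (gaussianPDFReal 0 v p.1 * gaussianPDFReal 0 a p.2) ∂((volume : Measure ℝ).prod volume)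
      = 2 / π * Real.arctan (2 * Real.sqrt a / Real.sqrt v) := by
  have ha' : (0 : ℝ) < a := by exact_mod_cast pos_iff_ne_zero.mpr ha
  have hv' : (0 : ℝ) < v := by exact_mod_cast pos_iff_ne_zero.mpr hv
  have hsa : 0 < Real.sqrt (a : ℝ) := Real.sqrt_pos.mpr ha'
  have hsv : 0 < Real.sqrt (v : ℝ) := Real.sqrt_pos.mpr hv'
  set c : ℝ := 2 * Real.sqrt a / Real.sqrt v with hcdef
  have hc : 0 < c := by positivity
  rw [gaussianSite_meanAccept_eq_signProb ha hv]
  -- the two sign events as sets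
  set Ele : Set (ℝ × ℝ) := {p | p.1 * (2 * p.2 + p.1) / (2 * a) ≤ 0} with hEle
  set Elt : Set (ℝ × ℝ) := {p | p.1 * (2 * p.2 + p.1) / (2 * a) < 0} with hElt
  have hf : Measurable fun p : ℝ × ℝ => p.1 * (2 * p.2 + p.1) / (2 * a) :=
    (measurable_fst.mul ((measurable_snd.const_mul 2).add measurable_fst)).div_const _
  have hElem : MeasurableSet Ele := measurableSet_le hf measurable_const
  have hEltm : MeasurableSet Elt := measurableSet_lt hf measurable_const
  rw [show (fun p : ℝ × ℝ => (if p.1 * (2 * p.2 + p.1) / (2 * a) ≤ 0 then (1 : ℝ) else 0)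
        * (gaussianPDFReal 0 v p.1 * gaussianPDFReal 0 a p.2))
      = fun p => (if p ∈ Ele then (1 : ℝ) else 0) * (gaussianPDFReal 0 v p.1 * gaussianPDFReal 0 a p.2)
      from rfl,
    show (fun p : ℝ × ℝ => (if p.1 * (2 * p.2 + p.1) / (2 * a) < 0 then (1 : ℝ) else 0)
        * (gaussianPDFReal 0 v p.1 * gaussianPDFReal 0 a p.2))
      = fun p => (if p ∈ Elt then (1 : ℝ) else 0) * (gaussianPDFReal 0 v p.1 * gaussianPDFReal 0 a p.2)
      from rfl,
    integral_ite_mul_stepTarget_prod hv ha hElem, integral_ite_mul_stepTarget_prod hv ha hEltm,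
    ← measureReal_def, ← measureReal_def, stepTarget_prod_eq_map v a,
    map_measureReal_apply ((measurable_const_mul (Real.sqrt (v : ℝ))).prodMap
      (measurable_const_mul (Real.sqrt (a : ℝ)))) hElem,
    map_measureReal_apply ((measurable_const_mul (Real.sqrt (v : ℝ))).prodMap
      (measurable_const_mul (Real.sqrt (a : ℝ)))) hEltm]
  -- pull the events back to the standard Gaussian pair: both become the wedge (up to a null line)
  set P : Measure (ℝ × ℝ) := (gaussianReal (0 : ℝ) 1).prod (gaussianReal (0 : ℝ) 1) with hP
  haveI : IsProbabilityMeasure P := by rw [hP]; infer_instance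
  have hscale : ∀ z : ℝ × ℝ, (Real.sqrt v * z.1) * (2 * (Real.sqrt a * z.2) + Real.sqrt v * z.1) / (2 * a)
      = ((v : ℝ) / (2 * a)) * (z.1 * (z.1 + c * z.2)) := by
    intro z
    rw [hcdef]
    have hv2 : Real.sqrt (v : ℝ) ^ 2 = v := Real.sq_sqrt hv'.le
    field_simp
    linear_combination (z.1 * (2 * Real.sqrt a * z.2 + Real.sqrt v * z.1)) * hv2
  have hk : 0 < (v : ℝ) / (2 * a) := by positivity
  have hpre_lt : (Prod.map (fun x : ℝ => Real.sqrt v * x) (fun x : ℝ => Real.sqrt a * x)) ⁻¹' Elt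
      = {z : ℝ × ℝ | z.1 * (z.1 + c * z.2) < 0} := by
    ext z
    simp only [hElt, mem_preimage, Prod.map, mem_setOf_eq, hscale z]
    rw [mul_neg_iff]
    constructor
    · rintro (⟨_, h⟩ | ⟨h, _⟩)
      · exact h
      · exact absurd hk (not_lt.mpr h.le)
    · intro h; exact Or.inl ⟨hk, h⟩
  have hpre_le : (Prod.map (fun x : ℝ => Real.sqrt v * x) (fun x : ℝ => Real.sqrt a * x)) ⁻¹' Ele
      = {z : ℝ × ℝ | z.1 * (z.1 + c * z.2) ≤ 0} := by
    ext z
    simp only [hEle, mem_preimage, Prod.map, mem_setOf_eq, hscale z]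
    rw [mul_nonpos_iff]
    constructor
    · rintro (⟨_, h⟩ | ⟨h, _⟩)
      · exact h
      · exact absurd hk (not_lt.mpr h)
    · intro h; exact Or.inl ⟨hk.le, h⟩
  rw [hpre_lt, hpre_le]
  -- the closed wedge exceeds the open one by a null set (the axis and one line)
  have hWm : MeasurableSet {z : ℝ × ℝ | z.1 * (z.1 + c * z.2) < 0} :=
    measurableSet_lt (measurable_fst.mul (measurable_fst.add (measurable_snd.const_mul c))) measurable_const
  have hle_eq : P.real {z : ℝ × ℝ | z.1 * (z.1 + c * z.2) ≤ 0} = P.real {z : ℝ × ℝ | z.1 * (z.1 + c * z.2) < 0} := by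
    apply le_antisymm
    · have hcov : {z : ℝ × ℝ | z.1 * (z.1 + c * z.2) ≤ 0}
          ⊆ {z : ℝ × ℝ | z.1 * (z.1 + c * z.2) < 0} ∪ ({z : ℝ × ℝ | z.1 = 0} ∪ {z | z.1 + c * z.2 = 0}) := by
        intro z hz
        simp only [mem_setOf_eq, mem_union] at hz ⊢
        rcases hz.lt_or_eq with h | h
        · exact Or.inl h
        · exact Or.inr (mul_eq_zero.mp h)
      have hnull : P.real ({z : ℝ × ℝ | z.1 = 0} ∪ {z | z.1 + c * z.2 = 0}) = 0 := by
        apply le_antisymm _ measureReal_nonneg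
        calc P.real ({z : ℝ × ℝ | z.1 = 0} ∪ {z | z.1 + c * z.2 = 0})
            ≤ P.real {z : ℝ × ℝ | z.1 = 0} + P.real {z : ℝ × ℝ | z.1 + c * z.2 = 0} :=
              measureReal_union_le _ _
          _ = 0 := by
              rw [measureReal_def, measureReal_def, hP, stdGaussianProd_axis_null,
                stdGaussianProd_line_null hc.ne']
              simp
      calc P.real {z : ℝ × ℝ | z.1 * (z.1 + c * z.2) ≤ 0}
          ≤ P.real ({z : ℝ × ℝ | z.1 * (z.1 + c * z.2) < 0} ∪ ({z : ℝ × ℝ | z.1 = 0} ∪ {z | z.1 + c * z.2 = 0})) :=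
            measureReal_mono hcov
        _ ≤ P.real {z : ℝ × ℝ | z.1 * (z.1 + c * z.2) < 0}
            + P.real ({z : ℝ × ℝ | z.1 = 0} ∪ {z | z.1 + c * z.2 = 0}) := measureReal_union_le _ _
        _ = _ := by rw [hnull, add_zero]
    · exact measureReal_mono (fun z (hz : z.1 * (z.1 + c * z.2) < 0) => hz.le)
  rw [hle_eq, hP, stdGaussianProd_real_wedge hc]
  field_simp
  ring

/-! ## §4 Two regimes: small steps accept, large steps pay `(4/π)·σ_π/σ_step` -/

/-- `arctan y ≤ y` for `y ≥ 0` (from Mathlib's `Real.le_tan`). -/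
private theorem arctan_le_self_of_nonneg {y : ℝ} (hy : 0 ≤ y) : Real.arctan y ≤ y := by
  have h1 : 0 ≤ Real.arctan y := Real.arctan_nonneg.mpr hy
  have h2 : Real.arctan y < π / 2 := Real.arctan_lt_pi_div_two y
  have h := Real.le_tan h1 h2
  rwa [Real.tan_arctan] at h

/-- **SMALL STEPS**: `ā ≥ 1 − √v/(π√a)` (from `arctan x = π/2 − arctan(1/x) ≥ π/2 − 1/x`);
**LARGE STEPS**: `ā ≤ 4√a/(π√v)` (from `arctan x ≤ x`). -/
theorem gaussianSite_meanAccept_bounds (ha : a ≠ 0) (hv : v ≠ 0) :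
    1 - Real.sqrt v / (π * Real.sqrt a)
        ≤ ∫ p : ℝ × ℝ, min 1 (Real.exp (-(p.1 * (2 * p.2 + p.1) / (2 * a))))
          * (gaussianPDFReal 0 v p.1 * gaussianPDFReal 0 a p.2) ∂((volume : Measure ℝ).prod volume)
    ∧ ∫ p : ℝ × ℝ, min 1 (Real.exp (-(p.1 * (2 * p.2 + p.1) / (2 * a))))
          * (gaussianPDFReal 0 v p.1 * gaussianPDFReal 0 a p.2) ∂((volume : Measure ℝ).prod volume)
        ≤ 4 * Real.sqrt a / (π * Real.sqrt v) := by
  have ha' : (0 : ℝ) < a := by exact_mod_cast pos_iff_ne_zero.mpr ha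
  have hv' : (0 : ℝ) < v := by exact_mod_cast pos_iff_ne_zero.mpr hv
  have hsa : 0 < Real.sqrt (a : ℝ) := Real.sqrt_pos.mpr ha'
  have hsv : 0 < Real.sqrt (v : ℝ) := Real.sqrt_pos.mpr hv'
  have hπ : 0 < π := pi_pos
  rw [gaussianSite_meanAccept ha hv]
  set x : ℝ := 2 * Real.sqrt a / Real.sqrt v with hx
  have hx0 : 0 < x := by positivity
  constructor
  · -- `arctan x = π/2 − arctan x⁻¹` and `arctan x⁻¹ ≤ x⁻¹ = √v/(2√a)`
    have hinv : Real.arctan x = π / 2 - Real.arctan x⁻¹ := by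
      rw [Real.arctan_inv_of_pos hx0]; ring
    have hle := arctan_le_self_of_nonneg (inv_pos.mpr hx0).le
    have hxinv : x⁻¹ = Real.sqrt v / (2 * Real.sqrt a) := by rw [hx, inv_div]
    rw [hinv, hxinv]
    rw [hxinv] at hle
    have : 2 / π * (π / 2 - Real.arctan (Real.sqrt v / (2 * Real.sqrt a)))
        = 1 - 2 / π * Real.arctan (Real.sqrt v / (2 * Real.sqrt a)) := by field_simp
    rw [this]
    have h3 : 2 / π * Real.arctan (Real.sqrt v / (2 * Real.sqrt a))
        ≤ 2 / π * (Real.sqrt v / (2 * Real.sqrt a)) :=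
      mul_le_mul_of_nonneg_left hle (by positivity)
    have h4 : 2 / π * (Real.sqrt v / (2 * Real.sqrt a)) = Real.sqrt v / (π * Real.sqrt a) := by
      field_simp
    linarith
  · have hle := arctan_le_self_of_nonneg hx0.le
    calc 2 / π * Real.arctan x ≤ 2 / π * x := mul_le_mul_of_nonneg_left hle (by positivity)
      _ = 4 * Real.sqrt a / (π * Real.sqrt v) := by rw [hx]; field_simp; ring

/-! ## §5 The law in the mean proposed energy change: `ā = 1 − (2/π)·arctan √(⟨ΔS⟩/2)` -/

/-- **The mean proposed energy change of the Gaussian-step update on the mode** is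
`⟨ΔS⟩ = E[U(2Φ + U)]/(2a) = v/(2a)` (`E[UΦ] = 0`, `E[U²] = v`), under `N(0,v) ⊗ N(0,a)`. -/
theorem gaussianSite_meanDeltaS (ha : a ≠ 0) (v : ℝ≥0) :
    ∫ p : ℝ × ℝ, p.1 * (2 * p.2 + p.1) / (2 * a) ∂((gaussianReal 0 v).prod (gaussianReal 0 a))
      = (v : ℝ) / (2 * a) := by
  have ha' : (0 : ℝ) < a := by exact_mod_cast pos_iff_ne_zero.mpr ha
  have hi1 : Integrable (fun x : ℝ => x) (gaussianReal 0 v) := (memLp_id_gaussianReal 1).integrable le_rfl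
  have hi2 : Integrable (fun x : ℝ => x ^ 2) (gaussianReal 0 v) := (memLp_id_gaussianReal 2).integrable_sq
  have hj1 : Integrable (fun y : ℝ => y) (gaussianReal 0 a) := (memLp_id_gaussianReal 1).integrable le_rfl
  have hsq : ∫ x, x ^ 2 ∂gaussianReal 0 v = v := by
    have hvar := variance_fun_id_gaussianReal (μ := (0 : ℝ)) (v := v)
    rw [variance_of_integral_eq_zero (by fun_prop) integral_id_gaussianReal] at hvar
    exact hvar
  have e : (fun p : ℝ × ℝ => p.1 * (2 * p.2 + p.1) / (2 * a))
      = fun p => (1 / (a : ℝ)) * (p.1 * p.2) + (1 / (2 * (a : ℝ))) * (p.1 ^ 2 * 1) := by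
    funext p; field_simp
  have hA : Integrable (fun p : ℝ × ℝ => p.1 * p.2) ((gaussianReal 0 v).prod (gaussianReal 0 a)) :=
    hi1.mul_prod hj1
  have hB : Integrable (fun p : ℝ × ℝ => p.1 ^ 2 * (1 : ℝ)) ((gaussianReal 0 v).prod (gaussianReal 0 a)) :=
    hi2.mul_prod (integrable_const 1)
  rw [e, integral_add (hA.const_mul _) (hB.const_mul _), integral_const_mul, integral_const_mul,
    integral_prod_mul (μ := gaussianReal 0 v) (ν := gaussianReal 0 a) (fun x : ℝ => x) (fun y : ℝ => y),
    integral_prod_mul (μ := gaussianReal 0 v) (ν := gaussianReal 0 a) (fun x : ℝ => x ^ 2) (fun _ : ℝ => (1 : ℝ)),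
    integral_id_gaussianReal, hsq]
  simp only [zero_mul, mul_zero, zero_add, integral_const, probReal_univ, smul_eq_mul, mul_one]
  field_simp

/-- **UNIVERSAL FORM IN `⟨ΔS⟩`**: with `m = ⟨ΔS⟩ = v/(2a)` the law of §3 reads
`ā = 1 − (2/π)·arctan √(m/2)` — the same curve as the free-field HMC mode law of
`FreeFieldHMCModeAcceptance` in ITS mean energy violation. -/
theorem gaussianSite_meanAccept_eq_meanEnergyChange (ha : a ≠ 0) (hv : v ≠ 0) :
    ∫ p : ℝ × ℝ, min 1 (Real.exp (-(p.1 * (2 * p.2 + p.1) / (2 * a))))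
        * (gaussianPDFReal 0 v p.1 * gaussianPDFReal 0 a p.2) ∂((volume : Measure ℝ).prod volume)
      = 1 - 2 / π * Real.arctan (Real.sqrt (((v : ℝ) / (2 * a)) / 2)) := by
  have ha' : (0 : ℝ) < a := by exact_mod_cast pos_iff_ne_zero.mpr ha
  have hv' : (0 : ℝ) < v := by exact_mod_cast pos_iff_ne_zero.mpr hv
  have hsa : 0 < Real.sqrt (a : ℝ) := Real.sqrt_pos.mpr ha'
  have hsv : 0 < Real.sqrt (v : ℝ) := Real.sqrt_pos.mpr hv'
  rw [gaussianSite_meanAccept ha hv]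
  have hx0 : 0 < 2 * Real.sqrt a / Real.sqrt v := by positivity
  -- `√(m/2) = √v/(2√a) = (2√a/√v)⁻¹`
  have hroot : Real.sqrt (((v : ℝ) / (2 * a)) / 2) = (2 * Real.sqrt a / Real.sqrt v)⁻¹ := by
    rw [inv_div, show ((v : ℝ) / (2 * a)) / 2 = (v : ℝ) / (2 ^ 2 * a) by ring, Real.sqrt_div' _ (by positivity),
      Real.sqrt_mul (by positivity), Real.sqrt_sq (by norm_num : (0 : ℝ) ≤ 2)]
  rw [hroot, Real.arctan_inv_of_pos hx0]
  field_simp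
  ring

end GaussianSite

end Summit.Ventures.LatticeQCDFlow.Exactness
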